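import Literature.MathematicalPhysics.QuantumFieldTheory.Balaban1983to89.B7GaugeFixingPureGauge

/-!
# `Balaban1983to89.B8Prop7BoxFormWitness` — THE WITNESS POTENTIAL of the box-form P₇-currency certificate `B8Prop7PrintedRZdGF3BoxFormInterTower`:
# `ψ(y) = κ₀(Σ_i y_i + q(y₀ − N))` on `ℤ⁴` — linear with print's maximal slope, bending quadratically (`q(t) = t(t−1)∕2`, `1 ≤ t ≤ L`, then slope
# `L − 1`) beyond the face `y₀ = N` of a depth-2 tower — its lattice differences, its block values and block MEANS, and the smallness of every
# difference fed to [Balaban1985Averaging]'s series logarithm (bookkeeping, kernel-checked; no estimate of the paper)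

statement-level skeleton of published theorems with citation tags; proofs where landed; nothing here is a claim about the Yang–Mills mass gap

T. Bałaban, *Spaces of regular gauge field configurations on a lattice and gauge fixing conditions*, Commun. Math. Phys. **99** (1985) 75–102
`[Balaban1985RegularSpaces]` ("B8"): (1.139)–(1.140) p. 100, Prop. 7 (1.145) p. 100.  T. Bałaban, *Averaging operations for lattice gauge
theories*, Commun. Math. Phys. **98** (1985) 17–51 `[Balaban1985Averaging]` ("[3]"): (2) p. 17, (21) p. 21, (42) p. 23.

## WHY THIS FILE (cell `pub-ymgap`, HUMAN RULING D-0062 ∕ D-0149 ∕ D-0154; N05 = [B8]; width seat `pub-ymgap-dag-n05-w5` g3, CLAIM-2 of 2026-08-28T08:07Z)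

The certificate's witness is a PURE GAUGE `U₁ = e^{−iη dψ∕η}`; by `B7GaugeFixingPureGauge` the gauge-fixed field between a depth-2 tower `T = B²(w)`
and an adjacent depth-1 tower `T′ = B¹(z′)` is `e^{i(M₂ψ(w) − M₁ψ(z′))}`.  This file is the arithmetic of that potential, split off the certificate so
that each declaration elaborates within the default heartbeat budget: (§0) the block sums over `[0,L)⁴` (`Σ_r f(r_{i₀}) = L³Σ_t f(t)`, `Σ_{t<L} t(t−1)∕2`,
the mean staircase `2(L−1)` at `d = 4`, the block mean of `Σ_i y_i`); (§2) the profile `q` and its first ∕ second differences (`profile_diff`,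
`profile_diff2`), the lattice differences of `ψ` (`potential_bounds`: `|Δψ| ≤ κ₀L`, `|ΔΔψ| ≤ κ₀` everywhere, `Δψ = κ₀`, `ΔΔψ = 0` left of `N` and
transversally — what (1.140) needs), its block values (`potential_values`), its block means (`block_means`: `M₁ψ(z) = κ₀(L·Σ_i z_i + 2(L−1))` on
1-blocks left of `N`, `+ κ₀(L−1)(L−2)∕6` on the 1-block based at `N`; `M₂ψ` = mean of means left of `N`), and the `< ln 2` smallness of the differences
on `T` and `T′` (`smallness`, under `κ₀L² = 0.9999·α₂`, `α₂ ≤ 1∕32`, `L ≥ 9`).  The potential and the means are passed as FUNCTIONS WITH THEIR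
DEFINING EQUATIONS DISPLAYED (no `def`).

## HONEST SCOPE

Finite sums and elementary inequalities; NO estimate of [Balaban1985RegularSpaces] ∕ [Balaban1985Averaging] is proved or asserted.
Count-neutral helper keyed `stmt-QuantumFields-26907` (K1⁸ `StabilityBRunRowsAtRecordR13SepCoPH`, route rev 27; successor of the aside K1⁷ 20542); N05 NOT discharged; no summit statement is proved by this seat — R4 closes the
conditional finite-`𝕋⁴` rung `BalabanLadder.UV` only; nothing continuum ∕ ℝ⁴ ∕ OS ∕ mass-gap ∕ Clay.  No `sorry`, no `def`, no `instance`, no `notation`.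
Unit `pub-ymgap-dag-n05-w5` (g3), 2026-08-28.

[cite: Balaban1985RegularSpaces, (1.139)–(1.140) p.100, Prop. 7 (1.145) p.100; Balaban1985Averaging, (2) p.17, (21) p.21, (42) p.23]
-/

noncomputable section

open NormedSpace Finset

namespace Literature.MathematicalPhysics.QuantumFieldTheory.Balaban1983to89.B8Prop7BoxFormWitness

open B7Prop1Explicit B7Prop1Local
open B8Ineq145 (stairMean stairMean_eq)
open B7GaugeFixingPureGauge (sum_inv_card_box)

-- `Site` alone could resolve to the torus sites of `Setup.lean`; re-export the `ℤ^d` sites of `B7Prop1Explicit`.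
export B7Prop1Explicit (Site)

/-! ## §0 Block sums -/

/-- A block sum of a function of ONE coordinate: `Σ_{r∈[0,L)⁴} f(r_{i₀}) = L³·Σ_{t<L} f(t)`. [cite: Balaban1985Averaging, (42) p.23 (bookkeeping: uniform block weights)] -/
theorem sum_box_coord (L : ℕ) (i₀ : Fin 4) (f : Fin L → ℝ) :
    ∑ r : Fin 4 → Fin L, f (r i₀) = (L : ℝ) ^ 3 * ∑ t : Fin L, f t := by
  rw [← Fintype.sum_equiv (Fin.insertNthEquiv (fun _ : Fin 4 => Fin L) i₀) (fun p => f p.1) (fun r => f (r i₀))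
    (fun p => by simp [Fin.insertNthEquiv_apply, Fin.insertNth_apply_same])]
  rw [Fintype.sum_prod_type]
  simp only [Finset.sum_const, Finset.card_univ, Fintype.card_pi, Fintype.card_fin, Finset.prod_const, nsmul_eq_mul]
  rw [Finset.mul_sum]
  push_cast
  rfl

/-- `Σ_{t<L} t(t−1)∕2 = L(L−1)(L−2)∕6` — the mean of the quadratic profile of the witness potential over a block row. [cite: Balaban1985RegularSpaces, (1.140) p.100 (bookkeeping: the witness potential)] -/
theorem sum_fin_choose_two (L : ℕ) :
    ∑ t : Fin L, ((t : ℕ) : ℝ) * (((t : ℕ) : ℝ) - 1) / 2 = (L : ℝ) * ((L : ℝ) - 1) * ((L : ℝ) - 2) / 6 := by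
  rw [Fin.sum_univ_eq_sum_range (fun t => (t : ℝ) * ((t : ℝ) - 1) / 2) L]
  induction L with
  | zero => simp
  | succ n ih =>
    rw [Finset.sum_range_succ, ih]
    push_cast
    ring

/-- The mean staircase `Σ_{r∈[0,L)⁴} L^{−4}·Σ_i r_i = 2(L−1)` (`B8Ineq145.stairMean_eq` at `d = 4`). [cite: Balaban1985Averaging, (2) p.17 (bookkeeping)] -/
theorem sum_box_stair {L : ℕ} (hL : 1 ≤ L) :
    ∑ r : Fin 4 → Fin L, ((L : ℝ) ^ 4)⁻¹ * ∑ i, ((r i : ℕ) : ℝ) = 2 * ((L : ℝ) - 1) := by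
  rw [← Finset.mul_sum]
  have h := stairMean_eq 4 L (by omega)
  unfold stairMean at h
  rw [div_eq_inv_mul] at h
  rw [h]
  push_cast
  ring

/-- The block mean of the coordinate sum: `Σ_r L^{−4}·Σ_i (Lz + r)_i = L·Σ_i z_i + 2(L−1)`. [cite: Balaban1985Averaging, (42) p.23 (bookkeeping: uniform block weights)] -/
theorem mean_coordSum {L : ℕ} (hL : 1 ≤ L) (z : Site 4) :
    ∑ r : Fin 4 → Fin L, ((L : ℝ) ^ 4)⁻¹ * ∑ i, ((((L : ℤ) • z + boxVec L r) i : ℤ) : ℝ)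
      = (L : ℝ) * (∑ i, ((z i : ℤ) : ℝ)) + 2 * ((L : ℝ) - 1) := by
  have hsplit : ∀ r : Fin 4 → Fin L, (∑ i, ((((L : ℤ) • z + boxVec L r) i : ℤ) : ℝ))
      = (L : ℝ) * (∑ i, ((z i : ℤ) : ℝ)) + ∑ i, ((r i : ℕ) : ℝ) := by
    intro r
    rw [Finset.mul_sum, ← Finset.sum_add_distrib]
    refine Finset.sum_congr rfl fun i _ => ?_
    simp only [Pi.add_apply, Pi.smul_apply, smul_eq_mul, boxVec]
    push_cast
    ring
  simp_rw [hsplit, mul_add, Finset.sum_add_distrib, ← Finset.sum_mul, sum_inv_card_box hL, one_mul, sum_box_stair hL]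

/-! ## §2 The witness potential: profile, lattice differences, block values, block means, smallness -/

section Witness

/-- The quadratic-then-linear profile of the witness potential across the depth-1 top : `q(t) = 0` (`t ≤ 1`),
`t(t−1)∕2` (`1 ≤ t ≤ L`), then slope `L − 1`. Its first difference. [cite: Balaban1985RegularSpaces, (1.140) p.100 (bookkeeping: the witness potential)] -/
theorem profile_diff (L : ℕ) (hL : 2 ≤ L) (t : ℤ) :
    (if t + 1 ≤ 1 then (0 : ℝ) else if t + 1 ≤ (L : ℤ) then ((t + 1 : ℤ) : ℝ) * (((t + 1 : ℤ) : ℝ) - 1) / 2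
        else (L : ℝ) * ((L : ℝ) - 1) / 2 + ((L : ℝ) - 1) * (((t + 1 : ℤ) : ℝ) - L))
      - (if t ≤ 1 then (0 : ℝ) else if t ≤ (L : ℤ) then ((t : ℤ) : ℝ) * (((t : ℤ) : ℝ) - 1) / 2
        else (L : ℝ) * ((L : ℝ) - 1) / 2 + ((L : ℝ) - 1) * (((t : ℤ) : ℝ) - L))
      = (if t ≤ 0 then (0 : ℝ) else if t ≤ (L : ℤ) - 1 then ((t : ℤ) : ℝ) else (L : ℝ) - 1) := by
  have hL' : (2 : ℤ) ≤ L := by exact_mod_cast hL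
  rcases le_or_gt t 0 with h0 | h0
  · rw [if_pos (by omega), if_pos (by omega), if_pos h0]; ring
  rcases eq_or_lt_of_le (show 1 ≤ t by omega) with h1 | h1
  · subst h1
    rw [if_neg (by omega), if_pos (by omega), if_pos le_rfl, if_neg (by omega), if_pos (by omega)]
    push_cast; ring
  rcases le_or_gt t ((L : ℤ) - 1) with h2 | h2
  · rw [if_neg (by omega), if_pos (by omega), if_neg (by omega), if_pos (by omega), if_neg (by omega), if_pos h2]
    push_cast; ring
  rcases eq_or_lt_of_le (show (L : ℤ) ≤ t by omega) with h3 | h3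
  · subst h3
    rw [if_neg (by omega), if_neg (by omega), if_neg (by omega), if_pos le_rfl, if_neg (by omega), if_neg (by omega)]
    push_cast; ring
  · rw [if_neg (by omega), if_neg (by omega), if_neg (by omega), if_neg (by omega), if_neg (by omega), if_neg (by omega)]
    push_cast; ring

/-- The second difference of the profile lies in `[0, 1]` and vanishes left of the top. [cite: Balaban1985RegularSpaces, (1.140) p.100 (bookkeeping: the witness potential)] -/
theorem profile_diff2 (L : ℕ) (hL : 2 ≤ L) (t : ℤ) :
    0 ≤ (if t + 1 ≤ 0 then (0 : ℝ) else if t + 1 ≤ (L : ℤ) - 1 then ((t + 1 : ℤ) : ℝ) else (L : ℝ) - 1)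
        - (if t ≤ 0 then (0 : ℝ) else if t ≤ (L : ℤ) - 1 then ((t : ℤ) : ℝ) else (L : ℝ) - 1) ∧
    (if t + 1 ≤ 0 then (0 : ℝ) else if t + 1 ≤ (L : ℤ) - 1 then ((t + 1 : ℤ) : ℝ) else (L : ℝ) - 1)
        - (if t ≤ 0 then (0 : ℝ) else if t ≤ (L : ℤ) - 1 then ((t : ℤ) : ℝ) else (L : ℝ) - 1) ≤ 1 := by
  have hL' : (2 : ℤ) ≤ L := by exact_mod_cast hL
  have hLr : (2 : ℝ) ≤ L := by exact_mod_cast hL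
  rcases le_or_gt (t + 1) 0 with h0 | h0
  · rw [if_pos h0, if_pos (by omega)]; norm_num
  rcases le_or_gt t 0 with h1 | h1
  · have ht : t = 0 := by omega
    subst ht
    rw [if_neg (by omega), if_pos (by omega), if_pos le_rfl]; norm_num
  rcases le_or_gt (t + 1) ((L : ℤ) - 1) with h2 | h2
  · rw [if_neg (by omega), if_pos h2, if_neg (by omega), if_pos (by omega)]; push_cast; constructor <;> linarith
  rcases le_or_gt t ((L : ℤ) - 1) with h3 | h3
  · have ht : t = (L : ℤ) - 1 := by omega
    subst ht
    rw [if_neg (by omega), if_neg (by omega), if_neg (by omega), if_pos le_rfl]; push_cast; constructor <;> linarith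
  · rw [if_neg (by omega), if_neg (by omega), if_neg (by omega), if_neg (by omega)]; constructor <;> linarith


/-- The lattice differences of the witness potential `ψ(y) = κ₀(Σ_i y_i + q(y₀ − N))` : `|Δψ| ≤ κ₀L`, `|ΔΔψ| ≤ κ₀` everywhere;
`Δψ = κ₀`, `ΔΔψ = 0` left of `N` and in the transverse directions. [cite: Balaban1985RegularSpaces, (1.140) p.100 (bookkeeping: the witness potential)] -/
theorem potential_bounds (L : ℕ) (hL2 : 2 ≤ L) (N : ℤ) {κ₀ : ℝ} (hκ₀ : 0 < κ₀) (q : ℤ → ℝ)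
    (hq : ∀ t : ℤ, q t = (if t ≤ 1 then (0 : ℝ) else if t ≤ (L : ℤ) then ((t : ℤ) : ℝ) * (((t : ℤ) : ℝ) - 1) / 2
        else (L : ℝ) * ((L : ℝ) - 1) / 2 + ((L : ℝ) - 1) * (((t : ℤ) : ℝ) - L)))
    (ψ : Site 4 → ℝ) (hψ : ∀ y : Site 4, ψ y = κ₀ * ((∑ j, ((y j : ℤ) : ℝ)) + q (y 0 - N))) :
    (∀ (y : Site 4) (τ : Fin 4), |ψ (y + e τ) - ψ y| ≤ κ₀ * L) ∧
    (∀ (y : Site 4) (τ : Fin 4), (y 0 - N ≤ -1 ∨ τ ≠ 0) → ψ (y + e τ) - ψ y = κ₀) ∧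
    (∀ (y : Site 4) (τ κ : Fin 4), |(ψ (y + e κ + e τ) - ψ (y + e κ)) - (ψ (y + e τ) - ψ y)| ≤ κ₀) ∧
    (∀ (y : Site 4) (τ κ : Fin 4), (y 0 - N ≤ -1 ∨ τ ≠ 0) → (ψ (y + e κ + e τ) - ψ (y + e κ)) - (ψ (y + e τ) - ψ y) = 0) := by
  have hL1 : 1 ≤ L := by omega
  have hL1r : (1 : ℝ) ≤ L := by exact_mod_cast hL1
  set dq : ℤ → ℝ := fun t => if t ≤ 0 then (0 : ℝ) else if t ≤ (L : ℤ) - 1 then ((t : ℤ) : ℝ) else (L : ℝ) - 1 with hdqdef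
  have hdq : ∀ t, q (t + 1) - q t = dq t := fun t => by rw [hq, hq, hdqdef]; exact profile_diff L hL2 t
  have hddq : ∀ t, 0 ≤ dq (t + 1) - dq t ∧ dq (t + 1) - dq t ≤ 1 := fun t => by rw [hdqdef]; exact profile_diff2 L hL2 t
  have hdq0 : ∀ t, t ≤ 0 → dq t = 0 := fun t ht => by rw [hdqdef]; exact if_pos ht
  have hdqbd : ∀ t, 0 ≤ dq t ∧ dq t ≤ (L : ℝ) - 1 := fun t => by
    rw [hdqdef]; dsimp only
    split_ifs with ha hb
    · constructor <;> linarith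
    · constructor
      · exact_mod_cast (show (0 : ℤ) ≤ t by omega)
      · have : ((t : ℤ) : ℝ) ≤ (((L : ℤ) - 1 : ℤ) : ℝ) := by exact_mod_cast hb
        push_cast at this; exact this
    · constructor <;> linarith
  have hSadd : ∀ (y v : Site 4), (∑ j, (((y + v) j : ℤ) : ℝ)) = (∑ j, ((y j : ℤ) : ℝ)) + ∑ j, ((v j : ℤ) : ℝ) := fun y v => by
    rw [← Finset.sum_add_distrib]
    exact Finset.sum_congr rfl fun j _ => by push_cast [Pi.add_apply]; ring
  have hSe : ∀ τ : Fin 4, (∑ j, ((e τ j : ℤ) : ℝ)) = 1 := fun τ => by simp [e_apply]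
  have hΔ : ∀ (y : Site 4) (τ : Fin 4), ψ (y + e τ) - ψ y = κ₀ * (1 + (q ((y + e τ) 0 - N) - q (y 0 - N))) := by
    intro y τ; rw [hψ, hψ, hSadd, hSe]; ring
  have hΔ0 : ∀ y : Site 4, ψ (y + e 0) - ψ y = κ₀ * (1 + dq (y 0 - N)) := fun y => by
    rw [hΔ, Pi.add_apply, e_apply, if_pos rfl, show y 0 + 1 - N = (y 0 - N) + 1 by ring, hdq]
  have hΔne : ∀ (y : Site 4) (τ : Fin 4), τ ≠ 0 → ψ (y + e τ) - ψ y = κ₀ := fun y τ hτ => by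
    rw [hΔ, Pi.add_apply, e_apply, if_neg (fun h => hτ h.symm), add_zero, sub_self, add_zero, mul_one]
  refine ⟨fun y τ => ?_, fun y τ h => ?_, fun y τ κ => ?_, fun y τ κ h => ?_⟩
  · by_cases hτ : τ = 0
    · subst hτ
      rw [hΔ0, abs_of_nonneg (by nlinarith [(hdqbd (y 0 - N)).1])]
      nlinarith [(hdqbd (y 0 - N)).2]
    · rw [hΔne y τ hτ, abs_of_pos hκ₀]; nlinarith
  · by_cases hτ : τ = 0
    · subst hτ
      have hy : y 0 - N ≤ -1 := h.resolve_right (fun h' => h' rfl)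
      rw [hΔ0, hdq0 _ (by omega), add_zero, mul_one]
    · exact hΔne y τ hτ
  · by_cases hτ : τ = 0
    · subst hτ
      rw [hΔ0, hΔ0, Pi.add_apply, e_apply]
      by_cases hκ : (0 : Fin 4) = κ
      · rw [if_pos hκ, show y 0 + 1 - N = (y 0 - N) + 1 by ring,
          show κ₀ * (1 + dq (y 0 - N + 1)) - κ₀ * (1 + dq (y 0 - N)) = κ₀ * (dq (y 0 - N + 1) - dq (y 0 - N)) by ring,
          abs_of_nonneg (mul_nonneg hκ₀.le (hddq _).1)]
        nlinarith [(hddq (y 0 - N)).2]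
      · rw [if_neg hκ, add_zero, sub_self, abs_zero]; exact hκ₀.le
    · rw [hΔne _ τ hτ, hΔne _ τ hτ, sub_self, abs_zero]; exact hκ₀.le
  · by_cases hτ : τ = 0
    · subst hτ
      have hy : y 0 - N ≤ -1 := h.resolve_right (fun h' => h' rfl)
      rw [hΔ0, hΔ0, Pi.add_apply, e_apply]
      by_cases hκ : (0 : Fin 4) = κ
      · rw [if_pos hκ, show y 0 + 1 - N = (y 0 - N) + 1 by ring, hdq0 _ (by omega), hdq0 _ (by omega)]; ring
      · rw [if_neg hκ, add_zero, sub_self]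
    · rw [hΔne _ τ hτ, hΔne _ τ hτ, sub_self]

/-- The values of the witness potential on blocks left of `N` (where the profile vanishes) and on the block based at `N`. [cite: Balaban1985RegularSpaces, (1.140) p.100 (bookkeeping: the witness potential)] -/
theorem potential_values (L : ℕ) (hL1 : 1 ≤ L) (N : ℤ) (κ₀ : ℝ) (q : ℤ → ℝ)
    (hq : ∀ t : ℤ, q t = (if t ≤ 1 then (0 : ℝ) else if t ≤ (L : ℤ) then ((t : ℤ) : ℝ) * (((t : ℤ) : ℝ) - 1) / 2
        else (L : ℝ) * ((L : ℝ) - 1) / 2 + ((L : ℝ) - 1) * (((t : ℤ) : ℝ) - L)))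
    (ψ : Site 4 → ℝ) (hψ : ∀ y : Site 4, ψ y = κ₀ * ((∑ j, ((y j : ℤ) : ℝ)) + q (y 0 - N))) :
    (∀ (p : Site 4) (r : Fin 4 → Fin L), p 0 - N ≤ -L → ψ (p + boxVec L r) - ψ p = κ₀ * ∑ j, ((r j : ℕ) : ℝ)) ∧
    (∀ (p : Site 4) (r : Fin 4 → Fin L), p 0 = N →
      ψ (p + boxVec L r) - ψ p = κ₀ * ((∑ j, ((r j : ℕ) : ℝ)) + ((r 0 : ℕ) : ℝ) * (((r 0 : ℕ) : ℝ) - 1) / 2)) ∧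
    (∀ y : Site 4, y 0 - N ≤ 1 → ψ y = κ₀ * ∑ j, ((y j : ℤ) : ℝ)) ∧
    (∀ t : Fin L, q ((t : ℕ) : ℤ) = ((t : ℕ) : ℝ) * (((t : ℕ) : ℝ) - 1) / 2) := by
  have hq0 : ∀ t, t ≤ 1 → q t = 0 := fun t ht => by rw [hq]; exact if_pos ht
  have hqfin : ∀ t : Fin L, q ((t : ℕ) : ℤ) = ((t : ℕ) : ℝ) * (((t : ℕ) : ℝ) - 1) / 2 := fun t => by
    rw [hq]
    have ht : ((t : ℕ) : ℤ) ≤ (L : ℤ) := by exact_mod_cast t.isLt.le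
    split_ifs with ha
    · have : (t : ℕ) = 0 ∨ (t : ℕ) = 1 := by omega
      rcases this with h | h <;> simp [h]
    · push_cast; ring
  have hSadd : ∀ (y v : Site 4), (∑ j, (((y + v) j : ℤ) : ℝ)) = (∑ j, ((y j : ℤ) : ℝ)) + ∑ j, ((v j : ℤ) : ℝ) := fun y v => by
    rw [← Finset.sum_add_distrib]
    exact Finset.sum_congr rfl fun j _ => by push_cast [Pi.add_apply]; ring
  have hboxsum : ∀ r : Fin 4 → Fin L, (∑ j, ((boxVec L r j : ℤ) : ℝ)) = ∑ j, ((r j : ℕ) : ℝ) := fun r =>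
    Finset.sum_congr rfl fun j _ => by simp [boxVec]
  have hcoord : ∀ (p : Site 4) (r : Fin 4 → Fin L), (p + boxVec L r) 0 = p 0 + ((r 0 : ℕ) : ℤ) := fun _ _ => rfl
  refine ⟨fun p r hp => ?_, fun p r hp => ?_, fun y hy => ?_, hqfin⟩
  · have hr0 : ((r 0 : ℕ) : ℤ) ≤ (L : ℤ) - 1 := by have := (r 0).isLt; omega
    rw [hψ, hψ, hSadd, hboxsum, hq0 ((p + boxVec L r) 0 - N) (by rw [hcoord]; linarith), hq0 (p 0 - N) (by linarith)]; ring
  · rw [hψ, hψ, hSadd, hboxsum, show (p + boxVec L r) 0 - N = ((r 0 : ℕ) : ℤ) by rw [hcoord]; linarith,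
      show p 0 - N = 0 by linarith, hqfin (r 0), hq0 0 (by norm_num)]
    ring
  · rw [hψ, hq0 _ hy, add_zero]

/-- The block means of the witness potential : on a 1-block whose bottom row is left of `N` the mean is the linear part
`κ₀(L·Σ_i z_i + 2(L−1))`; on the 1-block based at `N` the profile adds `κ₀(L−1)(L−2)∕6`; on a 2-block left of `N` the mean of means.
[cite: Balaban1985Averaging, (42) p.23 (bookkeeping: uniform block weights)] -/
theorem block_means (L : ℕ) (hL1 : 1 ≤ L) (N : ℤ) (κ₀ : ℝ) (q : ℤ → ℝ)
    (hq : ∀ t : ℤ, q t = (if t ≤ 1 then (0 : ℝ) else if t ≤ (L : ℤ) then ((t : ℤ) : ℝ) * (((t : ℤ) : ℝ) - 1) / 2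
        else (L : ℝ) * ((L : ℝ) - 1) / 2 + ((L : ℝ) - 1) * (((t : ℤ) : ℝ) - L)))
    (ψ : Site 4 → ℝ) (hψ : ∀ y : Site 4, ψ y = κ₀ * ((∑ j, ((y j : ℤ) : ℝ)) + q (y 0 - N)))
    (M₁ : Site 4 → ℝ) (hM₁ : ∀ z : Site 4, M₁ z = ∑ r : Fin 4 → Fin L, ((L : ℝ) ^ 4)⁻¹ * ψ ((L : ℤ) • z + boxVec L r))
    (M₂ : Site 4 → ℝ) (hM₂ : ∀ v : Site 4, M₂ v = ∑ s : Fin 4 → Fin L, ((L : ℝ) ^ 4)⁻¹ * M₁ ((L : ℤ) • v + boxVec L s)) :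
    (∀ z : Site 4, (∀ t : Fin L, (L : ℤ) * z 0 + ((t : ℕ) : ℤ) - N ≤ 1) →
      M₁ z = κ₀ * ((L : ℝ) * (∑ j, ((z j : ℤ) : ℝ)) + 2 * ((L : ℝ) - 1))) ∧
    (∀ z : Site 4, (L : ℤ) * z 0 = N →
      M₁ z = κ₀ * ((L : ℝ) * (∑ j, ((z j : ℤ) : ℝ)) + 2 * ((L : ℝ) - 1)
        + ((L : ℝ) ^ 4)⁻¹ * ((L : ℝ) ^ 3 * ((L : ℝ) * ((L : ℝ) - 1) * ((L : ℝ) - 2) / 6)))) ∧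
    (∀ v : Site 4, (∀ (s : Fin 4 → Fin L) (t : Fin L), (L : ℤ) * (((L : ℤ) • v + boxVec L s) 0) + ((t : ℕ) : ℤ) - N ≤ 1) →
      M₂ v = κ₀ * ((L : ℝ) * ((L : ℝ) * (∑ j, ((v j : ℤ) : ℝ)) + 2 * ((L : ℝ) - 1)) + 2 * ((L : ℝ) - 1))) := by
  have hq0 : ∀ t, t ≤ 1 → q t = 0 := fun t ht => by rw [hq]; exact if_pos ht
  obtain ⟨-, -, -, hqfin⟩ := potential_values L hL1 N κ₀ q hq ψ hψ
  -- `M₁` in general: linear part + profile part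
  have hM₁gen : ∀ z : Site 4, M₁ z = κ₀ * ((L : ℝ) * (∑ j, ((z j : ℤ) : ℝ)) + 2 * ((L : ℝ) - 1)
      + ((L : ℝ) ^ 4)⁻¹ * ((L : ℝ) ^ 3 * ∑ t : Fin L, q (L * z 0 + ((t : ℕ) : ℤ) - N))) := by
    intro z
    have hq' : ∀ r : Fin 4 → Fin L, q (((L : ℤ) • z + boxVec L r) 0 - N) = q (L * z 0 + ((r 0 : ℕ) : ℤ) - N) := fun r => by
      simp [boxVec]
    calc M₁ z = ∑ r : Fin 4 → Fin L, ((L : ℝ) ^ 4)⁻¹ * ψ ((L : ℤ) • z + boxVec L r) := hM₁ z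
      _ = ∑ r : Fin 4 → Fin L, (κ₀ * (((L : ℝ) ^ 4)⁻¹ * ∑ j, ((((L : ℤ) • z + boxVec L r) j : ℤ) : ℝ))
            + κ₀ * (((L : ℝ) ^ 4)⁻¹ * q (L * z 0 + ((r 0 : ℕ) : ℤ) - N))) :=
          Finset.sum_congr rfl fun r _ => by rw [hψ, hq' r]; ring
      _ = κ₀ * (∑ r : Fin 4 → Fin L, ((L : ℝ) ^ 4)⁻¹ * ∑ j, ((((L : ℤ) • z + boxVec L r) j : ℤ) : ℝ))
            + κ₀ * (((L : ℝ) ^ 4)⁻¹ * ∑ r : Fin 4 → Fin L, q (L * z 0 + ((r 0 : ℕ) : ℤ) - N)) := by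
          simp only [Finset.mul_sum, Finset.sum_add_distrib]
      _ = _ := by rw [mean_coordSum hL1 z, sum_box_coord L 0 (fun t => q (L * z 0 + ((t : ℕ) : ℤ) - N))]; ring
  have hM₁T : ∀ z : Site 4, (∀ t : Fin L, (L : ℤ) * z 0 + ((t : ℕ) : ℤ) - N ≤ 1) →
      M₁ z = κ₀ * ((L : ℝ) * (∑ j, ((z j : ℤ) : ℝ)) + 2 * ((L : ℝ) - 1)) := by
    intro z hz
    rw [hM₁gen z, Finset.sum_eq_zero (fun t _ => hq0 _ (hz t)), mul_zero, mul_zero, add_zero]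
  refine ⟨hM₁T, fun z hz => ?_, fun v hv => ?_⟩
  · rw [hM₁gen z]
    have : ∀ t : Fin L, q (L * z 0 + ((t : ℕ) : ℤ) - N) = ((t : ℕ) : ℝ) * (((t : ℕ) : ℝ) - 1) / 2 := fun t => by
      rw [show (L : ℤ) * z 0 + ((t : ℕ) : ℤ) - N = ((t : ℕ) : ℤ) by linarith [hz], hqfin]
    simp_rw [this, sum_fin_choose_two]
  · calc M₂ v = ∑ s : Fin 4 → Fin L, ((L : ℝ) ^ 4)⁻¹ * M₁ ((L : ℤ) • v + boxVec L s) := hM₂ v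
      _ = ∑ s : Fin 4 → Fin L, (κ₀ * (L : ℝ) * (((L : ℝ) ^ 4)⁻¹ * ∑ j, ((((L : ℤ) • v + boxVec L s) j : ℤ) : ℝ))
            + κ₀ * (2 * ((L : ℝ) - 1)) * ((L : ℝ) ^ 4)⁻¹) :=
          Finset.sum_congr rfl fun s _ => by rw [hM₁T _ (hv s)]; ring
      _ = κ₀ * (L : ℝ) * (∑ s : Fin 4 → Fin L, ((L : ℝ) ^ 4)⁻¹ * ∑ j, ((((L : ℤ) • v + boxVec L s) j : ℤ) : ℝ))
            + κ₀ * (2 * ((L : ℝ) - 1)) * ∑ _s : Fin 4 → Fin L, ((L : ℝ) ^ 4)⁻¹ := by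
          simp only [Finset.mul_sum, Finset.sum_add_distrib]
      _ = _ := by rw [mean_coordSum hL1 v, sum_inv_card_box hL1]; ring

/-- The series-logarithm smallness on the blocks of `T` and on `T′`: every difference fed to [Balaban1985Averaging]'s `log` (21) is `< ln 2`. [cite: Balaban1985Averaging, (21) p.21 (bookkeeping: smallness for the series logarithm)] -/
theorem smallness (L : ℕ) (hL9 : 9 ≤ L) (N : ℤ) {κ₀ α₂ : ℝ} (hκ₀ : 0 < κ₀) (h32 : α₂ ≤ 1 / 32)
    (hκ₀L2 : κ₀ * (L : ℝ) ^ 2 = 9999 / 10000 * α₂) (q : ℤ → ℝ)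
    (hq : ∀ t : ℤ, q t = (if t ≤ 1 then (0 : ℝ) else if t ≤ (L : ℤ) then ((t : ℤ) : ℝ) * (((t : ℤ) : ℝ) - 1) / 2
        else (L : ℝ) * ((L : ℝ) - 1) / 2 + ((L : ℝ) - 1) * (((t : ℤ) : ℝ) - L)))
    (ψ : Site 4 → ℝ) (hψ : ∀ y : Site 4, ψ y = κ₀ * ((∑ j, ((y j : ℤ) : ℝ)) + q (y 0 - N)))
    (M₁ : Site 4 → ℝ) (hM₁ : ∀ z : Site 4, M₁ z = ∑ r : Fin 4 → Fin L, ((L : ℝ) ^ 4)⁻¹ * ψ ((L : ℤ) • z + boxVec L r))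
    (w : Site 4) (hw : ∀ j, w j = L) (hN : N = L * (L * L + (L - 1)) + (L - 1) + 1) (z' : Site 4) (hz'N : (L : ℤ) * z' 0 - N = 0) :
    (∀ (s r : Fin 4 → Fin L), |ψ ((L : ℤ) • ((L : ℤ) • w + boxVec L s) + boxVec L r) - ψ ((L : ℤ) • ((L : ℤ) • w + boxVec L s))| < Real.log 2) ∧
    (∀ s : Fin 4 → Fin L, |M₁ ((L : ℤ) • w + boxVec L s) - M₁ ((L : ℤ) • w)| < Real.log 2) ∧
    (∀ r : Fin 4 → Fin L, |ψ ((L : ℤ) • z' + boxVec L r) - ψ ((L : ℤ) • z')| < Real.log 2) := by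
  have hL1 : 1 ≤ L := by omega
  have hLr : (9 : ℝ) ≤ L := by exact_mod_cast hL9
  have hlog2 := Real.log_two_gt_d9
  have hLpos : (0 : ℝ) < L := by linarith
  have h0 : 0 < α₂ := by nlinarith [mul_pos hκ₀ (pow_pos hLpos 2)]
  have hκ₀L : κ₀ * L ≤ κ₀ * (L : ℝ) ^ 2 := by nlinarith
  obtain ⟨hψT, hψN, -, -⟩ := potential_values L hL1 N κ₀ q hq ψ hψ
  obtain ⟨hM₁T, -, -⟩ := block_means L hL1 N κ₀ q hq ψ hψ M₁ hM₁ (fun v => ∑ s : Fin 4 → Fin L, ((L : ℝ) ^ 4)⁻¹ * M₁ ((L : ℤ) • v + boxVec L s))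
    (fun _ => rfl)
  have hboxle : ∀ r : Fin 4 → Fin L, (∑ j, ((r j : ℕ) : ℝ)) ≤ 4 * ((L : ℝ) - 1) := fun r => by
    have h4 : ∀ j, ((r j : ℕ) : ℝ) ≤ (L : ℝ) - 1 := fun j => by
      have := (r j).isLt
      have : ((r j : ℕ) : ℝ) + 1 ≤ L := by exact_mod_cast this
      linarith
    calc (∑ j, ((r j : ℕ) : ℝ)) ≤ ∑ _j : Fin 4, ((L : ℝ) - 1) := Finset.sum_le_sum fun j _ => h4 j
      _ = 4 * ((L : ℝ) - 1) := by rw [Finset.sum_const, Finset.card_univ, Fintype.card_fin, nsmul_eq_mul]; push_cast; ring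
  have hboxnn : ∀ r : Fin 4 → Fin L, 0 ≤ ∑ j, ((r j : ℕ) : ℝ) := fun r => Finset.sum_nonneg fun j _ => by positivity
  have hSadd : ∀ (y v : Site 4), (∑ j, (((y + v) j : ℤ) : ℝ)) = (∑ j, ((y j : ℤ) : ℝ)) + ∑ j, ((v j : ℤ) : ℝ) := fun y v => by
    rw [← Finset.sum_add_distrib]
    exact Finset.sum_congr rfl fun j _ => by push_cast [Pi.add_apply]; ring
  have hboxsum : ∀ r : Fin 4 → Fin L, (∑ j, ((boxVec L r j : ℤ) : ℝ)) = ∑ j, ((r j : ℕ) : ℝ) := fun r =>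
    Finset.sum_congr rfl fun j _ => by simp [boxVec]
  have hblk : ∀ (s : Fin 4 → Fin L) (t : Fin L), (L : ℤ) * (((L : ℤ) • w + boxVec L s) 0) + ((t : ℕ) : ℤ) - N ≤ 1 := by
    intro s t
    have hs : ((s 0 : ℕ) : ℤ) ≤ (L : ℤ) - 1 := by have := (s 0).isLt; omega
    have ht : ((t : ℕ) : ℤ) ≤ (L : ℤ) - 1 := by have := t.isLt; omega
    simp only [Pi.add_apply, Pi.smul_apply, smul_eq_mul, boxVec, hw]
    rw [hN]; nlinarith
  have hblk0 : ∀ t : Fin L, (L : ℤ) * (((L : ℤ) • w) 0) + ((t : ℕ) : ℤ) - N ≤ 1 := by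
    intro t
    have ht : ((t : ℕ) : ℤ) ≤ (L : ℤ) - 1 := by have := t.isLt; omega
    simp only [Pi.smul_apply, smul_eq_mul, hw]
    rw [hN]; nlinarith
  refine ⟨fun s r => ?_, fun s => ?_, fun r => ?_⟩
  · have hs : ((s 0 : ℕ) : ℤ) ≤ (L : ℤ) - 1 := by have := (s 0).isLt; omega
    rw [hψT _ r (by simp only [Pi.add_apply, Pi.smul_apply, smul_eq_mul, boxVec, hw]; rw [hN]; nlinarith),
      abs_of_nonneg (mul_nonneg hκ₀.le (hboxnn r))]
    calc κ₀ * ∑ j, ((r j : ℕ) : ℝ) ≤ κ₀ * (4 * ((L : ℝ) - 1)) := mul_le_mul_of_nonneg_left (hboxle r) hκ₀.le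
      _ ≤ 4 * (κ₀ * (L : ℝ) ^ 2) := by nlinarith
      _ < Real.log 2 := by nlinarith
  · rw [hM₁T _ (hblk s), hM₁T _ hblk0, hSadd, hboxsum,
      show κ₀ * ((L : ℝ) * ((∑ j, ((((L : ℤ) • w) j : ℤ) : ℝ)) + ∑ j, ((s j : ℕ) : ℝ)) + 2 * ((L : ℝ) - 1))
        - κ₀ * ((L : ℝ) * (∑ j, ((((L : ℤ) • w) j : ℤ) : ℝ)) + 2 * ((L : ℝ) - 1)) = κ₀ * L * ∑ j, ((s j : ℕ) : ℝ) by ring,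
      abs_of_nonneg (mul_nonneg (by positivity) (hboxnn s))]
    calc κ₀ * L * ∑ j, ((s j : ℕ) : ℝ) ≤ κ₀ * L * (4 * ((L : ℝ) - 1)) := mul_le_mul_of_nonneg_left (hboxle s) (by positivity)
      _ ≤ 4 * (κ₀ * (L : ℝ) ^ 2) := by nlinarith
      _ < Real.log 2 := by nlinarith
  · have hr0 : ((r 0 : ℕ) : ℝ) ≤ (L : ℝ) - 1 := by
      have := (r 0).isLt
      have : ((r 0 : ℕ) : ℝ) + 1 ≤ L := by exact_mod_cast this
      linarith
    have hr0' : (0 : ℝ) ≤ ((r 0 : ℕ) : ℝ) := by positivity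
    have hquad : 0 ≤ ((r 0 : ℕ) : ℝ) * (((r 0 : ℕ) : ℝ) - 1) / 2 ∧ ((r 0 : ℕ) : ℝ) * (((r 0 : ℕ) : ℝ) - 1) / 2 ≤ (L : ℝ) ^ 2 / 2 := by
      constructor
      · rcases Nat.eq_zero_or_pos (r 0 : ℕ) with h | h
        · rw [h]; norm_num
        · have : (1 : ℝ) ≤ ((r 0 : ℕ) : ℝ) := by exact_mod_cast h
          nlinarith
      · nlinarith
    rw [hψN _ r (by simp only [Pi.smul_apply, smul_eq_mul]; linarith [hz'N]),
      abs_of_nonneg (mul_nonneg hκ₀.le (by linarith [hboxnn r, hquad.1]))]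
    calc κ₀ * ((∑ j, ((r j : ℕ) : ℝ)) + ((r 0 : ℕ) : ℝ) * (((r 0 : ℕ) : ℝ) - 1) / 2)
        ≤ κ₀ * (4 * ((L : ℝ) - 1) + (L : ℝ) ^ 2 / 2) := mul_le_mul_of_nonneg_left (by linarith [hboxle r, hquad.2]) hκ₀.le
      _ ≤ 4 * (κ₀ * (L : ℝ) ^ 2) + κ₀ * (L : ℝ) ^ 2 / 2 := by nlinarith
      _ < Real.log 2 := by nlinarith

end Witness

end Literature.MathematicalPhysics.QuantumFieldTheory.Balaban1983to89.B8Prop7BoxFormWitness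

end
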